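import Literature.NumberTheory.Automorphic.UnitaryGroupUnipotentHaarTorusConj
import Literature.MeasureTheory.Group.FundamentalDomainLatticeSum
import HarnessLib

/-!
# Counting the rational Borel elements that meet a compact set: the cell count along `B(F) = T(F) N(F)`
# and the `δ_B`-scaling of the cells under `B(𝔸_F)`-conjugation
(Rogawski, *Automorphic Representations of Unitary Groups in Three Variables* (1990), §2.2, p. 13; Weil,
*Adeles and Algebraic Groups* / Basic Number Theory, Chap. I n° 12: counting lattice points by the measure
of the cells they fill)

Topic `NumberTheory/Automorphic`; namespace `Literature.NumberTheory.Automorphic.UnitaryGroup`. THEOREMS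
ONLY over accepted tree modules: no definition, no named fact, no `sorry`, no instance, no notation.
This is brick H4 («count `#R(g) ≤ C · δ_B`») of the cell road to the integrability of Arthur's truncated
kernel `k^T` on `U(3)` (★ `UnitaryGroupTruncatedKernelCellBound`: `‖k^T(g)‖ ≤ #R(g) · ε`, `R(g)` the
finite set of `β ∈ B(F)` with `g⁻¹ β (y g) ∈ supp f` for some `y ∈ {1} ∪ U`), in coordinate-free form:

* §1 (every `N`) **`card_mul_measure_le_tsum_measure`** — for a left-invariant measure `ν` on `N(𝔸_F)`,
  a fundamental domain `𝓕` of `N(F)`, `x ∈ G(𝔸_F)`, `C ⊆ G(𝔸_F)`, `U ⊆ N(𝔸_F)` and a finite `R ⊆ B(F)`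
  with `x⁻¹ β (y x) ∈ C` for some `y ∈ U` (each `β ∈ R`):
  `#R · ν(𝓕) ≤ Σ'_{t ∈ T(F)} ν(A_t(x, C) · U⁻¹ · 𝓕)`, `A_t(x, C) = {m ∈ N(𝔸_F) : x⁻¹ t m x ∈ C}` —
  write `β = t n` along ★ `exists_equiv_arithmeticBorel_prod` and count the a.e.-disjoint cells `n 𝓕`,
  `n ∈ N(F)`, fibre by fibre (★ `Literature.MeasureTheory.Group.card_mul_measure_le_of_smul_subset`);
  only the finitely many `t` of ★ `finite_setOf_rationalTorus_meets_support` contribute.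
* §2 (`N = 3`) **`measure_borelConj_preimage`**, **`measure_image_borelConj_symm`** — for every Haar
  measure `ν` of `N(𝔸_F)`, `b ∈ B(𝔸_F)` and EVERY set `X ⊆ N(𝔸_F)`:
  `ν {u : b⁻¹ u b ∈ X} = δ_B(b) · ν(X)`, `δ_B(b) = torusRootModulus E 3 (diagUnit b)`
  (★ `map_borelConj_eq_torusRootModulus_smul` through the measurable automorphism `u ↦ b⁻¹ u b`).
* §3 (`N = 3`) **`measure_cellSet_borel_mul_le`** — the `x = b k` step:
  `ν(A_t(b k, C) · W) ≤ δ_B(b) · ν(A_t(k, C) · b⁻¹ W b)`, since `b⁻¹ t m b = t [t, b] (b⁻¹ m b)` with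
  `[t, b] = t⁻¹ b⁻¹ t b ∈ N(𝔸_F)` (★ `torus_commutator_mem_adelicUnipotent`), so
  `b⁻¹ (A_t(bk, C) · W) b ⊆ [t, b]⁻¹ (A_t(k, C) · b⁻¹ W b)`, and §2 + left invariance. Hence
  `#R(b k) · ν(𝓕) ≤ δ_B(b) · Σ_t ν(A_t(k, C) · b⁻¹ (U⁻¹ 𝓕) b)` — the factor `δ_B` of the count; on a Siegel
  set (`k` in a compact, `b = u a`, `a` in the positive chamber) the remaining sets stay in compacta, which
  is the part controlled by the reduction-theory letters (H5/H6 of the road).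

## References

* J. D. Rogawski, *Automorphic Representations of Unitary Groups in Three Variables*, Annals of
  Mathematics Studies 123 (1990), §2.2 (p. 13) [Rogawski1990].
* A. Weil, *Basic Number Theory* (1967/1974), Chap. I [Weil1965].
-/

noncomputable section

open MeasureTheory NumberField IsDedekindDomain Topology Set
open scoped NNReal ENNReal MatrixGroups Pointwise

namespace Literature.NumberTheory.Automorphic

namespace UnitaryGroup

variable {F E : Type} [Field F] [NumberField F] [Field E] [NumberField E] [Algebra F E]
  {c : E ≃ₐ[F] E} {N : ℕ}

/-! ## §1 The cell count along `B(F) = T(F) N(F)` -/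

section Count

variable [MeasurableSpace (adelicUnipotent F E c N)] [BorelSpace (adelicUnipotent F E c N)]

/-- **CELL COUNT ALONG `B(F) = T(F) N(F)`.** For a left-invariant measure `ν` on `N(𝔸_F)`, a fundamental
domain `𝓕` of `N(F)`, `x ∈ G(𝔸_F)`, `C ⊆ G(𝔸_F)`, `U ⊆ N(𝔸_F)` and a finite set `R ⊆ B(F)` such that every
`β ∈ R` has `x⁻¹ β (y x) ∈ C` for some `y ∈ U`:
`#R · ν(𝓕) ≤ Σ'_{t ∈ T(F)} ν(A_t · U⁻¹ · 𝓕)`, `A_t = {m ∈ N(𝔸_F) : x⁻¹ t m x ∈ C}`. Indeed `β = t n`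
(`t ∈ T(F)`, `n ∈ N(F)`, ★ `exists_equiv_arithmeticBorel_prod`), `n y ∈ A_t`, so the cell `n 𝓕` lies in
`A_t U⁻¹ 𝓕`; the cells of distinct `n ∈ N(F)` are a.e. disjoint of measure `ν(𝓕)`
(★ `card_mul_measure_le_of_smul_subset`). [cite: Rogawski1990, §2.2 (p. 13)] -/
theorem card_mul_measure_le_tsum_measure (ν : Measure (adelicUnipotent F E c N)) [ν.IsMulLeftInvariant]
    {𝓕 : Set (adelicUnipotent F E c N)} (h𝓕 : IsFundamentalDomain (rationalUnipotent F E c N) 𝓕 ν)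
    (x : (quasiSplit F E c N).Adelic) (C : Set (quasiSplit F E c N).Adelic) (U : Set (adelicUnipotent F E c N))
    (R : Finset (arithmeticBorel F E c N))
    (hR : ∀ β ∈ R, ∃ y ∈ U, x⁻¹ * (((β : (quasiSplit F E c N).arithmeticSubgroup)) : (quasiSplit F E c N).Adelic) *
      (((y : adelicUnipotent F E c N) : (quasiSplit F E c N).Adelic) * x) ∈ C) :
    (R.card : ℝ≥0∞) * ν 𝓕 ≤ ∑' t : rationalTorus F E c N,
      ν ({m : adelicUnipotent F E c N | x⁻¹ * ((t : torusAdelic F E c N) : (quasiSplit F E c N).Adelic) *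
          ((m : adelicUnipotent F E c N) : (quasiSplit F E c N).Adelic) * x ∈ C} * (U⁻¹ * 𝓕)) := by
  classical
  haveI : MeasurableConstSMul (rationalUnipotent F E c N) (adelicUnipotent F E c N) :=
    ⟨fun γ => (continuous_const.mul continuous_id).measurable⟩
  haveI : SMulInvariantMeasure (rationalUnipotent F E c N) (adelicUnipotent F E c N) ν :=
    ⟨fun γ s _hs => by
      rw [show (fun u : adelicUnipotent F E c N => γ • u) ⁻¹' s =
          (fun u : adelicUnipotent F E c N => ((γ : adelicUnipotent F E c N)) * u) ⁻¹' s from rfl,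
        measure_preimage_mul]⟩
  obtain ⟨e, he⟩ := exists_equiv_arithmeticBorel_prod (F := F) (E := E) (c := c) (N := N)
  -- the torus-part fibres of `R`
  set τ : arithmeticBorel F E c N → rationalTorus F E c N := fun β => (e β).1 with hτ
  set S : Finset (rationalTorus F E c N) := R.image τ with hS
  set Rt : rationalTorus F E c N → Finset (rationalUnipotent F E c N) :=
    fun t => (R.filter (fun β => τ β = t)).image (fun β => (e β).2) with hRt
  -- `#R = Σ_{t ∈ S} #R_t`
  have hcard : R.card = ∑ t ∈ S, (Rt t).card := by
    rw [Finset.card_eq_sum_card_fiberwise (f := τ) (t := S) (fun β hβ => Finset.mem_image_of_mem τ hβ)]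
    refine Finset.sum_congr rfl fun t _ => ?_
    rw [hRt, Finset.card_image_of_injOn]
    intro β hβ β' hβ' h
    have h1 : (e β).1 = (e β').1 := by
      have hb := (Finset.mem_filter.1 (Finset.mem_coe.1 hβ)).2
      have hb' := (Finset.mem_filter.1 (Finset.mem_coe.1 hβ')).2
      change (e β).1 = t at hb
      change (e β').1 = t at hb'
      rw [hb, hb']
    exact e.injective (Prod.ext h1 h)
  -- the cells of the fibre over `t` lie in `A_t U⁻¹ 𝓕`
  have hcell : ∀ t : rationalTorus F E c N, ((Rt t).card : ℝ≥0∞) * ν 𝓕 ≤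
      ν ({m : adelicUnipotent F E c N | x⁻¹ * ((t : torusAdelic F E c N) : (quasiSplit F E c N).Adelic) *
          ((m : adelicUnipotent F E c N) : (quasiSplit F E c N).Adelic) * x ∈ C} * (U⁻¹ * 𝓕)) := by
    intro t
    refine Literature.MeasureTheory.Group.card_mul_measure_le_of_smul_subset h𝓕 (Rt t) fun n hn => ?_
    obtain ⟨β, hβ, hβn⟩ := Finset.mem_image.1 hn
    obtain ⟨hβR, hβt⟩ := Finset.mem_filter.1 hβ
    obtain ⟨y, hyU, hy⟩ := hR β hβR
    -- `β = t n`
    have hβeq : (((β : (quasiSplit F E c N).arithmeticSubgroup)) : (quasiSplit F E c N).Adelic) =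
        ((t : torusAdelic F E c N) : (quasiSplit F E c N).Adelic) *
          ((n : adelicUnipotent F E c N) : (quasiSplit F E c N).Adelic) := by
      have h := he (e β)
      rw [Equiv.symm_apply_apply] at h
      rw [h, ← hβn]
      change ((((e β).1 : rationalTorus F E c N) : torusAdelic F E c N) : (quasiSplit F E c N).Adelic) * _ =
        ((t : torusAdelic F E c N) : (quasiSplit F E c N).Adelic) * _
      rw [show (e β).1 = t from hβt]
    intro v hv
    obtain ⟨u, hu, rfl⟩ := Set.mem_smul_set.1 hv
    refine Set.mem_mul.2 ⟨(n : adelicUnipotent F E c N) * y, ?_, y⁻¹ * u,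
      Set.mul_mem_mul (Set.inv_mem_inv.2 hyU) hu, ?_⟩
    · -- `n y ∈ A_t`
      change x⁻¹ * ((t : torusAdelic F E c N) : (quasiSplit F E c N).Adelic) *
          ((((n : adelicUnipotent F E c N) * y : adelicUnipotent F E c N)) : (quasiSplit F E c N).Adelic) * x ∈ C
      rw [Subgroup.coe_mul, show x⁻¹ * ((t : torusAdelic F E c N) : (quasiSplit F E c N).Adelic) *
          (((n : adelicUnipotent F E c N) : (quasiSplit F E c N).Adelic) *
            ((y : adelicUnipotent F E c N) : (quasiSplit F E c N).Adelic)) * x =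
          x⁻¹ * (((t : torusAdelic F E c N) : (quasiSplit F E c N).Adelic) *
            ((n : adelicUnipotent F E c N) : (quasiSplit F E c N).Adelic)) *
            (((y : adelicUnipotent F E c N) : (quasiSplit F E c N).Adelic) * x) by simp only [mul_assoc],
        ← hβeq]
      exact hy
    · -- `(n y) (y⁻¹ u) = n • u`
      change (n : adelicUnipotent F E c N) * y * (y⁻¹ * u) = (n : adelicUnipotent F E c N) * u
      rw [mul_assoc, mul_inv_cancel_left]
  calc (R.card : ℝ≥0∞) * ν 𝓕 = ∑ t ∈ S, ((Rt t).card : ℝ≥0∞) * ν 𝓕 := by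
        rw [hcard, Nat.cast_sum, Finset.sum_mul]
    _ ≤ ∑ t ∈ S, ν ({m : adelicUnipotent F E c N | x⁻¹ * ((t : torusAdelic F E c N) : (quasiSplit F E c N).Adelic) *
          ((m : adelicUnipotent F E c N) : (quasiSplit F E c N).Adelic) * x ∈ C} * (U⁻¹ * 𝓕)) :=
        Finset.sum_le_sum fun t _ => hcell t
    _ ≤ _ := ENNReal.sum_le_tsum S

omit [BorelSpace (adelicUnipotent F E c N)] in
/-- The `t`-summand of the cell count vanishes unless `t` meets the support: if no `m ∈ N(𝔸_F)` has
`x⁻¹ t m x ∈ C` then `A_t = ∅` and `ν(A_t U⁻¹ 𝓕) = 0`; with `C = supp f` compact only the finitely many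
`t` of ★ `finite_setOf_rationalTorus_meets_support` contribute. [cite: Rogawski1990, §2.2 (p. 13)] -/
theorem measure_cellSet_eq_zero_of_forall_not_mem (ν : Measure (adelicUnipotent F E c N))
    (x : (quasiSplit F E c N).Adelic) (C : Set (quasiSplit F E c N).Adelic) (U 𝓕 : Set (adelicUnipotent F E c N))
    (t : rationalTorus F E c N)
    (ht : ∀ m : adelicUnipotent F E c N, x⁻¹ * ((t : torusAdelic F E c N) : (quasiSplit F E c N).Adelic) *
      ((m : adelicUnipotent F E c N) : (quasiSplit F E c N).Adelic) * x ∉ C) :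
    ν ({m : adelicUnipotent F E c N | x⁻¹ * ((t : torusAdelic F E c N) : (quasiSplit F E c N).Adelic) *
        ((m : adelicUnipotent F E c N) : (quasiSplit F E c N).Adelic) * x ∈ C} * (U⁻¹ * 𝓕)) = 0 := by
  have h0 : {m : adelicUnipotent F E c N | x⁻¹ * ((t : torusAdelic F E c N) : (quasiSplit F E c N).Adelic) *
      ((m : adelicUnipotent F E c N) : (quasiSplit F E c N).Adelic) * x ∈ C} = ∅ :=
    Set.eq_empty_iff_forall_notMem.2 fun m hm => ht m hm
  rw [h0, Set.empty_mul, measure_empty]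

end Count

/-! ## §2 `N = 3`: conjugation by `B(𝔸_F)` scales the measure of every set by `δ_B` -/

section Three

variable [MeasurableSpace (adelicUnipotent F E c 3)] [BorelSpace (adelicUnipotent F E c 3)]

/-- **`ν {u : b⁻¹ u b ∈ X} = δ_B(b) · ν(X)` for EVERY set `X ⊆ N(𝔸_F)`**, every Haar measure `ν` of
`N(𝔸_F)` (`N = 3`) and every `b ∈ B(𝔸_F)`, `δ_B(b) = torusRootModulus E 3 (diagUnit b)` — i.e.
`ν(b X b⁻¹) = δ_B(b) ν(X)` (★ `map_borelConj_eq_torusRootModulus_smul` evaluated through the measurable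
automorphism `u ↦ b⁻¹ u b`, Mathlib `MeasurableEquiv.map_apply`, valid for non-measurable `X` too).
[cite: Rogawski1990, §2.2] -/
theorem measure_preimage_borelConj (hc : c * c = 1) (hc1 : c ≠ 1)
    (ν : Measure (adelicUnipotent F E c 3)) [ν.IsHaarMeasure] (b : borelAdelic F E c 3)
    (X : Set (adelicUnipotent F E c 3)) :
    ν {u : adelicUnipotent F E c 3 |
        (⟨(b : (quasiSplit F E c 3).Adelic)⁻¹ * (u : (quasiSplit F E c 3).Adelic) * (b : (quasiSplit F E c 3).Adelic),
          conj_mem_adelicUnipotent b.2 u.2⟩ : adelicUnipotent F E c 3) ∈ X} =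
      ((torusRootModulus E 3 (diagUnit b.2) : ℝ≥0) : ℝ≥0∞) * ν X := by
  obtain ⟨α, hα⟩ := exists_continuousMulEquiv_adelicUnipotent_conj (N := 3) b.2
  have hfun : (fun u : adelicUnipotent F E c 3 =>
      (⟨(b : (quasiSplit F E c 3).Adelic)⁻¹ * (u : (quasiSplit F E c 3).Adelic) * (b : (quasiSplit F E c 3).Adelic),
        conj_mem_adelicUnipotent b.2 u.2⟩ : adelicUnipotent F E c 3)) = α :=
    funext fun u => Subtype.ext (hα u).symm
  set ψ : adelicUnipotent F E c 3 ≃ᵐ adelicUnipotent F E c 3 := α.toHomeomorph.toMeasurableEquiv with hψ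
  have hψα : (ψ : adelicUnipotent F E c 3 → adelicUnipotent F E c 3) = α := rfl
  have hmap := map_borelConj_eq_torusRootModulus_smul hc hc1 ν b
  rw [hfun, ← hψα] at hmap
  have happ := MeasurableEquiv.map_apply ψ (μ := ν) X
  rw [hmap, Measure.smul_apply, smul_eq_mul] at happ
  have hset : {u : adelicUnipotent F E c 3 |
      (⟨(b : (quasiSplit F E c 3).Adelic)⁻¹ * (u : (quasiSplit F E c 3).Adelic) * (b : (quasiSplit F E c 3).Adelic),
        conj_mem_adelicUnipotent b.2 u.2⟩ : adelicUnipotent F E c 3) ∈ X} =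
      (ψ : adelicUnipotent F E c 3 → adelicUnipotent F E c 3) ⁻¹' X := by
    rw [hψα, ← hfun]
    rfl
  rw [hset]
  exact happ.symm

/-! ## §3 `N = 3`: the `δ_B`-factor of the count for `x = b k` -/

/-- **THE `δ_B`-FACTOR OF THE COUNT.** For `b ∈ B(𝔸_F)`, `k ∈ G(𝔸_F)`, `C ⊆ G(𝔸_F)`, `W ⊆ N(𝔸_F)`,
`t ∈ T(F)` and every Haar measure `ν` of `N(𝔸_F)` (`N = 3`), with `A_t(x) = {m : x⁻¹ t m x ∈ C}`:
`ν(A_t(b k) · W) ≤ δ_B(b) · ν(A_t(k) · b⁻¹ W b)`, `δ_B(b) = torusRootModulus E 3 (diagUnit b)`.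
[cite: Rogawski1990, §2.2 (p. 13)] -/
theorem measure_cellSet_borel_mul_le (hc : c * c = 1) (hc1 : c ≠ 1)
    (ν : Measure (adelicUnipotent F E c 3)) [ν.IsHaarMeasure] (b : borelAdelic F E c 3)
    (k : (quasiSplit F E c 3).Adelic) (C : Set (quasiSplit F E c 3).Adelic)
    (W : Set (adelicUnipotent F E c 3)) (t : rationalTorus F E c 3) :
    ν ({m : adelicUnipotent F E c 3 | ((b : (quasiSplit F E c 3).Adelic) * k)⁻¹ *
          ((t : torusAdelic F E c 3) : (quasiSplit F E c 3).Adelic) *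
          ((m : adelicUnipotent F E c 3) : (quasiSplit F E c 3).Adelic) * ((b : (quasiSplit F E c 3).Adelic) * k) ∈ C} * W) ≤
      ((torusRootModulus E 3 (diagUnit b.2) : ℝ≥0) : ℝ≥0∞) *
        ν ({m : adelicUnipotent F E c 3 | k⁻¹ * ((t : torusAdelic F E c 3) : (quasiSplit F E c 3).Adelic) *
            ((m : adelicUnipotent F E c 3) : (quasiSplit F E c 3).Adelic) * k ∈ C} *
          ((fun w : adelicUnipotent F E c 3 =>
            (⟨(b : (quasiSplit F E c 3).Adelic)⁻¹ * (w : (quasiSplit F E c 3).Adelic) * (b : (quasiSplit F E c 3).Adelic),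
              conj_mem_adelicUnipotent b.2 w.2⟩ : adelicUnipotent F E c 3)) '' W)) := by
  -- the conjugation `u ↦ b⁻¹ u b` as an automorphism `α`, and the commutator `cc = [t, b] ∈ N(𝔸_F)`
  obtain ⟨α, hα⟩ := exists_continuousMulEquiv_adelicUnipotent_conj (N := 3) b.2
  have hfun : (fun u : adelicUnipotent F E c 3 =>
      (⟨(b : (quasiSplit F E c 3).Adelic)⁻¹ * (u : (quasiSplit F E c 3).Adelic) * (b : (quasiSplit F E c 3).Adelic),
        conj_mem_adelicUnipotent b.2 u.2⟩ : adelicUnipotent F E c 3)) = α :=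
    funext fun u => Subtype.ext (hα u).symm
  obtain ⟨cc, hcc⟩ : ∃ cc : adelicUnipotent F E c 3, (cc : (quasiSplit F E c 3).Adelic) =
      (((t : torusAdelic F E c 3) : (quasiSplit F E c 3).Adelic))⁻¹ * (b : (quasiSplit F E c 3).Adelic)⁻¹ *
        ((t : torusAdelic F E c 3) : (quasiSplit F E c 3).Adelic) * (b : (quasiSplit F E c 3).Adelic) :=
    ⟨⟨_, torus_commutator_mem_adelicUnipotent (t : torusAdelic F E c 3).2 b⟩, rfl⟩
  -- §2 of the companion file, in terms of `α`
  have hscale : ∀ X : Set (adelicUnipotent F E c 3),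
      ν {u : adelicUnipotent F E c 3 | α u ∈ X} = ((torusRootModulus E 3 (diagUnit b.2) : ℝ≥0) : ℝ≥0∞) * ν X := by
    intro X
    have h := measure_preimage_borelConj hc hc1 ν b X
    have hset : {u : adelicUnipotent F E c 3 |
        (⟨(b : (quasiSplit F E c 3).Adelic)⁻¹ * (u : (quasiSplit F E c 3).Adelic) * (b : (quasiSplit F E c 3).Adelic),
          conj_mem_adelicUnipotent b.2 u.2⟩ : adelicUnipotent F E c 3) ∈ X} =
        {u : adelicUnipotent F E c 3 | α u ∈ X} :=
      Set.ext fun u => by rw [Set.mem_setOf_eq, Set.mem_setOf_eq, ← congrFun hfun u]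
    rw [hset] at h
    exact h
  rw [hfun]
  -- the inclusion `A_t(b k) · W ⊆ {u | [t,b] · α u ∈ A_t(k) · α(W)}`
  have hsub : {m : adelicUnipotent F E c 3 | ((b : (quasiSplit F E c 3).Adelic) * k)⁻¹ *
        ((t : torusAdelic F E c 3) : (quasiSplit F E c 3).Adelic) *
        ((m : adelicUnipotent F E c 3) : (quasiSplit F E c 3).Adelic) * ((b : (quasiSplit F E c 3).Adelic) * k) ∈ C} * W ⊆
      {u : adelicUnipotent F E c 3 | α u ∈ (fun v : adelicUnipotent F E c 3 => cc * v) ⁻¹'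
        ({m : adelicUnipotent F E c 3 | k⁻¹ * ((t : torusAdelic F E c 3) : (quasiSplit F E c 3).Adelic) *
            ((m : adelicUnipotent F E c 3) : (quasiSplit F E c 3).Adelic) * k ∈ C} * (α '' W))} := by
    rintro _ ⟨m, hm, w, hw, rfl⟩
    rw [Set.mem_setOf_eq, Set.mem_preimage, map_mul, ← mul_assoc]
    refine Set.mul_mem_mul ?_ (Set.mem_image_of_mem _ hw)
    rw [Set.mem_setOf_eq, Subgroup.coe_mul, hcc, hα m]
    rw [Set.mem_setOf_eq] at hm
    have hm' := hm
    simp only [mul_inv_rev, mul_assoc, mul_inv_cancel_left] at hm' ⊢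
    exact hm'
  calc ν ({m : adelicUnipotent F E c 3 | ((b : (quasiSplit F E c 3).Adelic) * k)⁻¹ *
          ((t : torusAdelic F E c 3) : (quasiSplit F E c 3).Adelic) *
          ((m : adelicUnipotent F E c 3) : (quasiSplit F E c 3).Adelic) * ((b : (quasiSplit F E c 3).Adelic) * k) ∈ C} * W)
      ≤ ν {u : adelicUnipotent F E c 3 | α u ∈ (fun v : adelicUnipotent F E c 3 => cc * v) ⁻¹'
          ({m : adelicUnipotent F E c 3 | k⁻¹ * ((t : torusAdelic F E c 3) : (quasiSplit F E c 3).Adelic) *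
              ((m : adelicUnipotent F E c 3) : (quasiSplit F E c 3).Adelic) * k ∈ C} * (α '' W))} :=
        measure_mono hsub
    _ = ((torusRootModulus E 3 (diagUnit b.2) : ℝ≥0) : ℝ≥0∞) *
          ν ((fun v : adelicUnipotent F E c 3 => cc * v) ⁻¹'
            ({m : adelicUnipotent F E c 3 | k⁻¹ * ((t : torusAdelic F E c 3) : (quasiSplit F E c 3).Adelic) *
              ((m : adelicUnipotent F E c 3) : (quasiSplit F E c 3).Adelic) * k ∈ C} * (α '' W))) := hscale _
    _ = ((torusRootModulus E 3 (diagUnit b.2) : ℝ≥0) : ℝ≥0∞) *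
          ν ({m : adelicUnipotent F E c 3 | k⁻¹ * ((t : torusAdelic F E c 3) : (quasiSplit F E c 3).Adelic) *
              ((m : adelicUnipotent F E c 3) : (quasiSplit F E c 3).Adelic) * k ∈ C} * (α '' W)) := by
        rw [measure_preimage_mul]

end Three

end UnitaryGroup

end Literature.NumberTheory.Automorphic
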